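/-
Copyright: the b2b-balaban T⁴-continuum CRUX team, row NE7b owner lineage `t4-ne7b-p1` (gen 116). Project licence.
-/
import Summits.QuantumFields.BalabanUV.T4Continuum.Spine.NE7b.SupBackgroundSemigroup

/-!
# THE INTERACTING SUP TOWER OVER ℕ IN CLOSED FORM: for the perturbed Gaussian skeleton on `ℓ^∞(ℤ^d)` (`d ≥ 3`), base side `ℓ + 1`,
# depth `J`, the family of (60)'s ONE-SHOT backgrounds `σ_j` at the composite sides `n_j + 1 = (ℓ+1)^j` for the canonically rescaled
# potentials `u_j = (ℓ+1)^{−2(J−j)}·u` IS a tower — `Q′_1∘Q′_j = Q′_{j+1}`, `σ_j(Q′_j(σ_{j+1} w)) = σ_{j+1} w` — in which EVERY level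
# carries (60)'s one-step letters with the SAME constants: Lipschitz `(N⁻¹ − c)⁻¹`, chart ball `(N⁻¹ − c)·r_j`, `‖Dσ_j‖ ≤ (N⁻¹ − c)⁻¹`;
# the k-uniform letter of the interacting sup column, closed form, no product (row NE7b, node U5c; (60) ∕ (76) BY NAME; [folklore])

Cell `pub-balaban`, sub-cell `t4`, spine estimate NE7b (`T4WeightBudget.RelWeightBound`; the cell's OWN estimate — NOT PRINTED in
[Bałaban 1983–89], NOT PROVED).  Crux-route work under `Spine/NE7b/` by the row OWNER (`t4-ne7b-p1` gen 116) under FREEZE (0)'s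
crux-prover clause (FILING-CLAIM C-ne7bp1-g116-5); NOTHING of Bałaban's is named, valued or asserted; no `T4Continuum/Support` leaf
typed; no `def`, no notation; zero `sorry`.  Imports (BY NAME): the owner's (76) `…SupBackgroundSemigroup` (`blockAvg_blockAvg`,
`background_eq_descends`; through it (60) `…SupSmallFieldBackground.exists_background`, (46) `one_le_supConst`, (49) `supConstG_nonneg`,
(57) `exists_clm_blockAvg`, (51) `abs_blockAvg_le`).

WHY (located).  Leaf-06's SET (`…SupEquationTower.tower_eq` ∕ `tower_eq_const`) runs the equation-map tower over ℕ for ANY charts and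
books the composite transport's Lipschitz letter as the DISPLAYED PRODUCT `∏_{j<k}(N_j⁻¹ − c_j)⁻¹` with radii `r_{k+1} < (N_k⁻¹ − c_k)r_k`
(PRICING-NE7b F784 ∕ F793 ∕ §3¹³⁵: «the k-uniform letter for the INTERACTING sup column — closed form or controlled product — REMAINS»).
(76) proved the two-level semigroup for (60)'s backgrounds: the big-side background factors through the small-side background of the
rescaled potential.  THIS FILE iterates it over ℕ: the side indices `n_j` (user data with `n_0 = 0`, `n_{j+1} + 1 = (n_j + 1)(ℓ + 1)`, i.e.
`n_j + 1 = (ℓ+1)^j`), the potentials `u_j = q^{J−j}·u` with `q = (ℓ+1)⁻²` (anchored at the coarsest level `J`, so every finer level has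
SMALLER constants and (60)'s hypotheses `(λ, L, c, N)` hold along the whole tower with the top level's values), the radii
`r_j = r∕(N⁻¹ − c)^{J−j}` (the chart ball of level `j` is EXACTLY the image ball of level `j+1`'s step branch).  Every `σ_j` is (60)'s
background at side `n_j + 1` — so (60) ∕ (63) ∕ (64) ∕ (75) ∕ the owner's weighted gradient rows apply at EVERY level with their side-free
constants — and consecutive levels are tied by (76)'s identity.  Against SET's dictionary: `Φ_j = σ_j` (composite transport),
`σ^{SET}_j = Q′_j∘σ_{j+1}` (step branch, a `(N⁻¹ − c)⁻¹`-Lipschitz section of the one-step average `Q′_1`), `Φ_{j+1} = Φ_j∘σ^{SET}_j`.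

WHAT IS PROVED ([folklore]; `ℓ^∞ := lp (fun _ : X d => ℝ) ∞`):
* §1 `pow_scale_letters` (the rescaled potential `q^m·u`, `0 ≤ q ≤ 1`, keeps (60)'s letters `u 0 = 0`, `|u′| ≤ λ`, `Lip u′ ≤ L`),
  `chartFactor_pos` ∕ `chartFactor_le_one` (`0 < N⁻¹ − c ≤ 1` under (60)'s `hN`, `c < N⁻¹`).
* §2 **`exists_background_tower`** — `d ≥ 3`, `a > 0`, (60)'s data `(u, u′, λ, L, c, N)`, side indices `n` with `n 0 = 0`,
  `n (j+1) + 1 = (n j + 1)(ℓ + 1)`, depth `J`, radius `r ≥ 0` ⟹ `∃ Q′ A P : ℕ → (ℓ^∞ →L ℓ^∞)`, `σ : ℕ → (ℓ^∞ → ℓ^∞)` with, AT EVERY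
  LEVEL `j`: the displayed actions at side `n j + 1`; `σ j 0 = 0`; on `‖w‖ ≤ (N⁻¹ − c)·r_j`: `‖σ_j w‖ ≤ r_j`, `Q′_j(σ_j w) = w`, the sitewise
  background system for the potential `q^{J−j}·u`; `(N⁻¹ − c)⁻¹`-Lipschitz; uniqueness in the `r_j`-ball; differentiability with
  `‖Dσ_j‖ ≤ (N⁻¹ − c)⁻¹`, `Q′_j∘Dσ_j = 1` on the open ball; AND THE TOWER: `Q′_1 ∘ Q′_j = Q′_{j+1}` for all `j`, and for `j < J`, on
  `‖w‖ ≤ (N⁻¹ − c)·r_{j+1}`: `Q′_j(σ_{j+1} w) ∈ closedBall 0 ((N⁻¹ − c)·r_j)` (`= closedBall 0 r_{j+1}`), `Q′_1(Q′_j(σ_{j+1} w)) = w`,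
  **`σ_j(Q′_j(σ_{j+1} w)) = σ_{j+1} w`**, and the step branch `w ↦ Q′_j(σ_{j+1} w)` is `(N⁻¹ − c)⁻¹`-Lipschitz there.
* §3 toy: the side indices `n_j = 2^j − 1` for `ℓ = 1`.

HONEST (what this is NOT).  The tower is the family of ONE-SHOT backgrounds read as a tower (print's own reading); SET's equation maps
`Eq_j` and charts in admissible-section form are not instantiated here (the `tower_eq_const` instance needs per-level charts for the
EFFECTIVE operators — (65)–(67),(70) give level one); derivative-level chain rule not typed; the scaling `q = (ℓ+1)⁻²` says (60)'s bounded
sitewise term is RELEVANT (mass-like) in this normalisation — anchoring at the top level is what makes the letters level-free; scalar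
`ℤ^d`, hard constraint; nothing of the covariant `H_k`, (A3) ∕ (A1c) (NC-NE7b-α UNRULED).  BY-NAME EFFECT ON THE WALL: NONE.  NE7b NOT
PRINTED ∕ NOT PROVED; spine PROVED 0∕9; rung (B)+1 on a FINITE torus — NOT infinite volume, NOT the mass gap, NOT Clay.  HONEST DEPENDENCY:
continuum YM on T⁴ ⇐ BetaPertH ∧ nine spine estimates (0∕9 proved); BetaPertH ⇐ (D1) ∧ (D4) ∧ CAP+tail; G-an2-4 gates asym, D1 and NE2∕3∕4.
-/

set_option autoImplicit false

noncomputable section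

namespace Summit.QuantumFields.BalabanUV.T4Continuum.NE7b.SupBackgroundTower

open scoped ENNReal NNReal
open Metric Set
open Literature.MathematicalPhysics.QuantumFieldTheory.Balaban1983to89
open B4Sect5Proof (latticeConst latticeConst_nonneg)
open B6QGQLower276 (X e blk B mem_B sum_B_const AX)
open B6QGQDecay237 (deltaU deltaU_pos)
open B5Hk103ScalarZd (nbhd deltaH deltaH_pos)
open Summit.QuantumFields.BalabanUV.Beta.D1BFx.BlockColumnSupNorm (cHs cHs_nonneg)
open Summit.QuantumFields.BalabanUV.Beta.D1BFx.PointColumnSplit (cKL cG0 cSplit)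
open Summit.QuantumFields.BalabanUV.Beta.D1BFx.PointColumnDecay (cFar)
open OneShotChartSupOperator (abs_apply_le_norm)
open FibreInverseSupNorm (abs_blockAvg_le)
open AugmentedSupEquivalence (exists_clm_blockAvg)
open SupSmallFieldBackground (exists_background)
open SupBackgroundSemigroup (blockAvg_blockAvg background_eq_descends)

variable {d : ℕ}

/-! ## §1. The rescaled potential keeps (60)'s letters; the chart factor -/

/-- **THE RESCALED POTENTIAL KEEPS THE LETTERS**: for `0 ≤ q ≤ 1` and any `m`, `q^m·u` has derivative `q^m·u′`, vanishes at `0`,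
`|q^m u′| ≤ λ`, and `q^m u′` is `L`-Lipschitz whenever `u` has these letters. [folklore] -/
theorem pow_scale_letters {q : ℝ} (hq0 : 0 ≤ q) (hq1 : q ≤ 1) (m : ℕ) {u u' : ℝ → ℝ} (hu : ∀ t, HasDerivAt u (u' t) t)
    (hu0 : u 0 = 0) {lam : ℝ} (hlam : ∀ t, |u' t| ≤ lam) {L : ℝ} (hL : ∀ s t, |u' s - u' t| ≤ L * |s - t|) :
    (∀ t, HasDerivAt (fun t => q ^ m * u t) (q ^ m * u' t) t) ∧ (fun t => q ^ m * u t) 0 = 0 ∧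
      (∀ t, |q ^ m * u' t| ≤ lam) ∧ (∀ s t, |q ^ m * u' s - q ^ m * u' t| ≤ L * |s - t|) := by
  have hqm0 : 0 ≤ q ^ m := pow_nonneg hq0 m
  have hqm1 : q ^ m ≤ 1 := pow_le_one₀ hq0 hq1
  refine ⟨fun t => (hu t).const_mul _, by simp only [hu0, mul_zero], fun t => ?_, fun s t => ?_⟩
  · rw [abs_mul, abs_of_nonneg hqm0]
    exact (mul_le_of_le_one_left (abs_nonneg _) hqm1).trans (hlam t)
  · rw [← mul_sub, abs_mul, abs_of_nonneg hqm0]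
    exact (mul_le_of_le_one_left (abs_nonneg _) hqm1).trans (hL s t)

/-- **THE CHART FACTOR IS POSITIVE**: `c < N⁻¹` gives `0 < N⁻¹ − c`. [folklore] -/
theorem chartFactor_pos {c N : ℝ≥0} (hcN : c < N⁻¹) : (0 : ℝ) < (N : ℝ)⁻¹ - c := by
  have h := NNReal.coe_lt_coe.2 hcN
  rw [NNReal.coe_inv] at h
  exact sub_pos.2 h

/-- **THE CHART FACTOR IS AT MOST ONE** (`d ≥ 3`): under (60)'s `N ≥ N_∞` one has `N ≥ C_∞ ≥ 1`, hence `N⁻¹ − c ≤ 1`. [folklore] -/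
theorem chartFactor_le_one (hd : 3 ≤ d) {a : ℝ} (ha : 0 < a) {c N : ℝ≥0}
    (hN : cHs d a * latticeConst d (deltaH d a)
        + ((cG0 d * cKL d (d - 2) + cSplit d a) * Real.exp (2 * deltaU d a)
            + cFar d a * Real.exp (4 * deltaU d a) / deltaU d a ^ 2) * latticeConst d (deltaU d a / 4)
          * (1 + cHs d a * latticeConst d (deltaH d a)) ≤ (N : ℝ)) :
    (N : ℝ)⁻¹ - c ≤ 1 := by
  have hCH1 : 1 ≤ cHs d a * latticeConst d (deltaH d a) := OneShotChartSupNorm.one_le_supConst hd 0 ha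
  have hCΓ0 : 0 ≤ ((cG0 d * cKL d (d - 2) + cSplit d a) * Real.exp (2 * deltaU d a)
      + cFar d a * Real.exp (4 * deltaU d a) / deltaU d a ^ 2) * latticeConst d (deltaU d a / 4)
        * (1 + cHs d a * latticeConst d (deltaH d a)) :=
    mul_nonneg (mul_nonneg (BlockPropagatorSupNorm.supConstG_nonneg d ha)
      (latticeConst_nonneg d (div_nonneg (deltaU_pos d ha).le zero_le_four))) (by linarith)
  have hN1 : (1 : ℝ) ≤ N := by linarith
  have h1 : (N : ℝ)⁻¹ ≤ 1 := inv_le_one_of_one_le₀ hN1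
  linarith [NNReal.coe_nonneg c]

/-! ## §2. The tower -/

/-- **THE INTERACTING SUP TOWER OVER ℕ IN CLOSED FORM** (`d ≥ 3`, `a > 0`; (60)'s data `u 0 = 0`, `|u′| ≤ λ`, `u′` `L`-Lipschitz,
`N ≥ N_∞`, `2λ ≤ c < N⁻¹`; side indices `n 0 = 0`, `n (j+1) + 1 = (n j + 1)(ℓ + 1)`; depth `J`; radius `r ≥ 0`; `q := ((ℓ+1)²)⁻¹`,
`r_j := r∕(N⁻¹ − c)^{J−j}`).  There are operators `Q′_j, A_j, P_j` and backgrounds `σ_j`, `j ∈ ℕ`, such that EVERY level `j` carries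
(60)'s letters at side `n j + 1` for the potential `q^{J−j}·u` and radius `r_j` (same `(N⁻¹ − c)⁻¹`, same `N`, same `c` at every
level), `Q′_1∘Q′_j = Q′_{j+1}`, and for `j < J`, on `‖w‖ ≤ (N⁻¹ − c)·r_{j+1}`: `Q′_j(σ_{j+1} w)` lies in level `j`'s chart ball,
`Q′_1(Q′_j(σ_{j+1} w)) = w`, **`σ_j(Q′_j(σ_{j+1} w)) = σ_{j+1} w`**, and `w ↦ Q′_j(σ_{j+1} w)` is `(N⁻¹ − c)⁻¹`-Lipschitz. [folklore] -/
theorem exists_background_tower (hd : 3 ≤ d) (ℓ : ℕ) {a : ℝ} (ha : 0 < a)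
    {u u' : ℝ → ℝ} (hu : ∀ t, HasDerivAt u (u' t) t) (hu0 : u 0 = 0) {lam c N : ℝ≥0} (hlam : ∀ t, |u' t| ≤ lam)
    {L : ℝ} (hL0 : 0 ≤ L) (hL : ∀ s t, |u' s - u' t| ≤ L * |s - t|)
    (hN : cHs d a * latticeConst d (deltaH d a)
        + ((cG0 d * cKL d (d - 2) + cSplit d a) * Real.exp (2 * deltaU d a)
            + cFar d a * Real.exp (4 * deltaU d a) / deltaU d a ^ 2) * latticeConst d (deltaU d a / 4)
          * (1 + cHs d a * latticeConst d (deltaH d a)) ≤ (N : ℝ))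
    (hc : 2 * lam ≤ c) (hcN : c < N⁻¹) (n : ℕ → ℕ) (hn0 : n 0 = 0) (hn : ∀ j, n (j + 1) + 1 = (n j + 1) * (ℓ + 1))
    (J : ℕ) {r : ℝ} (hr : 0 ≤ r) :
    ∃ (Dop Aop Pop : ℕ → (lp (fun _ : X d => ℝ) ∞ →L[ℝ] lp (fun _ : X d => ℝ) ∞))
      (σ : ℕ → (lp (fun _ : X d => ℝ) ∞ → lp (fun _ : X d => ℝ) ∞)),
      (∀ (j : ℕ) (f : lp (fun _ : X d => ℝ) ∞) (y : X d), Dop j f y = (((n j : ℝ) + 1) ^ d)⁻¹ * ∑ p ∈ B (n j) y, f p) ∧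
      (∀ (j : ℕ) (f : lp (fun _ : X d => ℝ) ∞) (p : X d), Aop j f p = ∑ r ∈ nbhd (n j) p, AX (n j) a p r * f r) ∧
      (∀ (j : ℕ) (f : lp (fun _ : X d => ℝ) ∞) (p : X d),
        Pop j f p = f p - (((n j : ℝ) + 1) ^ d)⁻¹ * ∑ p' ∈ B (n j) (blk (n j) p), f p') ∧
      (∀ j, σ j 0 = 0) ∧
      (∀ j, ∀ w ∈ closedBall (0 : lp (fun _ : X d => ℝ) ∞) (((N : ℝ)⁻¹ - c) * (r / ((N : ℝ)⁻¹ - c) ^ (J - j))),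
        σ j w ∈ closedBall 0 (r / ((N : ℝ)⁻¹ - c) ^ (J - j)) ∧ Dop j (σ j w) = w ∧
          ∀ p : X d, Aop j (σ j w) p + ((((ℓ : ℝ) + 1) ^ 2)⁻¹) ^ (J - j) * u (σ j w p)
            = (((n j : ℝ) + 1) ^ d)⁻¹ * ∑ p' ∈ B (n j) (blk (n j) p),
                (Aop j (σ j w) p' + ((((ℓ : ℝ) + 1) ^ 2)⁻¹) ^ (J - j) * u (σ j w p'))) ∧
      (∀ j, LipschitzOnWith (N⁻¹ - c)⁻¹ (σ j)
        (closedBall (0 : lp (fun _ : X d => ℝ) ∞) (((N : ℝ)⁻¹ - c) * (r / ((N : ℝ)⁻¹ - c) ^ (J - j))))) ∧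
      (∀ j, ∀ φ ∈ closedBall (0 : lp (fun _ : X d => ℝ) ∞) (r / ((N : ℝ)⁻¹ - c) ^ (J - j)),
        (∀ p : X d, Aop j φ p + ((((ℓ : ℝ) + 1) ^ 2)⁻¹) ^ (J - j) * u (φ p)
          = (((n j : ℝ) + 1) ^ d)⁻¹ * ∑ p' ∈ B (n j) (blk (n j) p),
              (Aop j φ p' + ((((ℓ : ℝ) + 1) ^ 2)⁻¹) ^ (J - j) * u (φ p'))) → σ j (Dop j φ) = φ) ∧
      (∀ j, ∀ w ∈ ball (0 : lp (fun _ : X d => ℝ) ∞) (((N : ℝ)⁻¹ - c) * (r / ((N : ℝ)⁻¹ - c) ^ (J - j))),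
        DifferentiableAt ℝ (σ j) w ∧ ‖fderiv ℝ (σ j) w‖ ≤ ((N : ℝ)⁻¹ - c)⁻¹ ∧
          (Dop j).comp (fderiv ℝ (σ j) w) = ContinuousLinearMap.id ℝ (lp (fun _ : X d => ℝ) ∞)) ∧
      -- THE TOWER
      (∀ j, (Dop 1).comp (Dop j) = Dop (j + 1)) ∧
      (∀ j, j < J → ∀ w ∈ closedBall (0 : lp (fun _ : X d => ℝ) ∞) (((N : ℝ)⁻¹ - c) * (r / ((N : ℝ)⁻¹ - c) ^ (J - (j + 1)))),
        Dop j (σ (j + 1) w) ∈ closedBall (0 : lp (fun _ : X d => ℝ) ∞) (((N : ℝ)⁻¹ - c) * (r / ((N : ℝ)⁻¹ - c) ^ (J - j))) ∧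
          Dop 1 (Dop j (σ (j + 1) w)) = w ∧ σ j (Dop j (σ (j + 1) w)) = σ (j + 1) w) ∧
      (∀ j, j < J → LipschitzOnWith (N⁻¹ - c)⁻¹ (fun w => Dop j (σ (j + 1) w))
        (closedBall (0 : lp (fun _ : X d => ℝ) ∞) (((N : ℝ)⁻¹ - c) * (r / ((N : ℝ)⁻¹ - c) ^ (J - (j + 1)))))) := by
  have hK := chartFactor_pos hcN
  have hK1 := chartFactor_le_one hd ha (c := c) hN
  have hq0 : (0 : ℝ) ≤ (((ℓ : ℝ) + 1) ^ 2)⁻¹ := by positivity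
  have hq1 : (((ℓ : ℝ) + 1) ^ 2)⁻¹ ≤ 1 :=
    inv_le_one_of_one_le₀ (one_le_pow₀ (by linarith [(Nat.cast_nonneg ℓ : (0 : ℝ) ≤ ℓ)]))
  have hrj : ∀ j, 0 ≤ r / ((N : ℝ)⁻¹ - c) ^ (J - j) := fun j => div_nonneg hr (pow_nonneg hK.le _)
  -- (60) at every level
  have hlev := fun j => exists_background hd (n j) ha (pow_scale_letters hq0 hq1 (J - j) hu hu0 hlam hL).1
    (pow_scale_letters hq0 hq1 (J - j) hu hu0 hlam hL).2.1 (lam := lam) (pow_scale_letters hq0 hq1 (J - j) hu hu0 hlam hL).2.2.1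
    hL0 (pow_scale_letters hq0 hq1 (J - j) hu hu0 hlam hL).2.2.2 hN hc hcN (hrj j)
  choose Dop Aop Pop σ hD hA hP hσ0 hσ hlip huniq hderiv using hlev
  -- the one-step average composes the level averages
  have hn1 : n 1 = ℓ := by have h := hn 0; simp only [hn0, zero_add, one_mul] at h; omega
  have hcomp : ∀ j, (Dop 1).comp (Dop j) = Dop (j + 1) := fun j =>
    ContinuousLinearMap.ext fun f => lp.ext (funext fun y => by
      rw [ContinuousLinearMap.comp_apply, hD, Finset.sum_congr rfl fun z _ => hD j f z, hD]
      have h := blockAvg_blockAvg (m := n j) (k := n 1) (n := n (j + 1)) (by rw [hn1]; exact hn j) (fun p => f p) y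
      rw [hn1] at h ⊢
      exact h)
  have hDn : ∀ (j : ℕ) (f : lp (fun _ : X d => ℝ) ∞), ‖Dop j f‖ ≤ ‖f‖ := fun j f =>
    lp.norm_le_of_forall_le (norm_nonneg f) fun y => by
      rw [Real.norm_eq_abs, hD]; exact abs_blockAvg_le (n j) (abs_apply_le_norm f) y
  -- radii: `r_{j+1} = (N⁻¹ − c)·r_j`
  have hrad : ∀ j, j < J → r / ((N : ℝ)⁻¹ - c) ^ (J - (j + 1)) = ((N : ℝ)⁻¹ - c) * (r / ((N : ℝ)⁻¹ - c) ^ (J - j)) := by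
    intro j hj
    have e : J - j = (J - (j + 1)) + 1 := by omega
    rw [e, pow_succ, ← div_div, mul_div_cancel₀ _ hK.ne']
  have hpot : ∀ j, j < J → ((((ℓ : ℝ) + 1) ^ 2)⁻¹) ^ (J - j) = (((ℓ : ℝ) + 1) ^ 2)⁻¹ * ((((ℓ : ℝ) + 1) ^ 2)⁻¹) ^ (J - (j + 1)) := by
    intro j hj
    have e : J - j = (J - (j + 1)) + 1 := by omega
    rw [e, pow_succ', ]
  -- the step between consecutive levels
  have hstep : ∀ j, j < J → ∀ w ∈ closedBall (0 : lp (fun _ : X d => ℝ) ∞)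
      (((N : ℝ)⁻¹ - c) * (r / ((N : ℝ)⁻¹ - c) ^ (J - (j + 1)))),
      Dop j (σ (j + 1) w) ∈ closedBall (0 : lp (fun _ : X d => ℝ) ∞) (((N : ℝ)⁻¹ - c) * (r / ((N : ℝ)⁻¹ - c) ^ (J - j))) ∧
        Dop 1 (Dop j (σ (j + 1) w)) = w ∧ σ j (Dop j (σ (j + 1) w)) = σ (j + 1) w := by
    intro j hj w hw
    obtain ⟨hball, hDw, hEL⟩ := hσ (j + 1) w hw
    rw [mem_closedBall, dist_zero_right] at hball
    have hside : n (j + 1) + 1 = (n j + 1) * (ℓ + 1) := hn j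
    -- the level-`(j+1)` background solves the level-`j` system for the rescaled potential
    have hELj : ∀ p : X d, Aop j (σ (j + 1) w) p + ((((ℓ : ℝ) + 1) ^ 2)⁻¹) ^ (J - j) * u (σ (j + 1) w p)
        = (((n j : ℝ) + 1) ^ d)⁻¹ * ∑ p' ∈ B (n j) (blk (n j) p),
            (Aop j (σ (j + 1) w) p' + ((((ℓ : ℝ) + 1) ^ 2)⁻¹) ^ (J - j) * u (σ (j + 1) w p')) := fun p => by
      simp only [hA, hpot j hj, mul_assoc]
      refine background_eq_descends hside a (fun t => ((((ℓ : ℝ) + 1) ^ 2)⁻¹) ^ (J - (j + 1)) * u t)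
        (fun q => σ (j + 1) w q) (fun q => ?_) p
      have h := hEL q
      simp only [hA] at h
      exact h
    refine ⟨?_, ?_, huniq j (σ (j + 1) w) ?_ hELj⟩
    · rw [mem_closedBall, dist_zero_right, ← hrad j hj]; exact (hDn j _).trans hball
    · rw [← ContinuousLinearMap.comp_apply, hcomp, hDw]
    · rw [mem_closedBall, dist_zero_right]
      refine hball.trans ?_
      rw [hrad j hj]
      exact mul_le_of_le_one_left (hrj j) hK1
  have hlipstep : ∀ j, j < J → LipschitzOnWith (N⁻¹ - c)⁻¹ (fun w => Dop j (σ (j + 1) w))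
      (closedBall (0 : lp (fun _ : X d => ℝ) ∞) (((N : ℝ)⁻¹ - c) * (r / ((N : ℝ)⁻¹ - c) ^ (J - (j + 1))))) :=
    fun j _ => LipschitzOnWith.of_dist_le_mul fun x hx y hy => by
      rw [dist_eq_norm, ← map_sub]
      exact (hDn j _).trans (by rw [← dist_eq_norm]; exact (hlip (j + 1)).dist_le_mul x hx y hy)
  exact ⟨Dop, Aop, Pop, σ, hD, hA, hP, hσ0, hσ, hlip, huniq, hderiv, hcomp, hstep, hlipstep⟩

/-! ## §3. Toy -/

/-- Toy: the side indices of the dyadic tower (`ℓ = 1`): `n_j = 2^j − 1` satisfies `n_0 = 0`, `n_{j+1} + 1 = (n_j + 1)·2`. -/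
example : (2 ^ 0 - 1 = 0) ∧ ∀ j : ℕ, (2 ^ (j + 1) - 1) + 1 = ((2 ^ j - 1) + 1) * (1 + 1) := by
  refine ⟨rfl, fun j => ?_⟩
  have h : 1 ≤ 2 ^ j := Nat.one_le_two_pow
  have h' : 1 ≤ 2 ^ (j + 1) := Nat.one_le_two_pow
  rw [Nat.sub_add_cancel h', Nat.sub_add_cancel h, pow_succ]

end Summit.QuantumFields.BalabanUV.T4Continuum.NE7b.SupBackgroundTower

end
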